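import Summits.CriticalPhenomena.PercolationContinuityZ3.Theorems.Transplant.SkelFrm1ReachRowsQUV
import Summits.CriticalPhenomena.PercolationContinuityZ3.Theorems.Transplant.SkelPhiReachRadiiQV
import Summits.CriticalPhenomena.PercolationContinuityZ3.Theorems.Transplant.SkelPhiNegReachDeepOV
import Summits.CriticalPhenomena.PercolationContinuityZ3.Theorems.Transplant.SkelFrmBParamsSlotsS
import Summits.CriticalPhenomena.PercolationContinuityZ3.Theorems.Transplant.SkelFrmBChoiceRadiiT
import Summits.CriticalPhenomena.PercolationContinuityZ3.Theorems.Transplant.SkelFrmBChoiceDefsV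
import Summits.CriticalPhenomena.PercolationContinuityZ3.Theorems.Transplant.SkelFrmBChoiceGeomV
import Summits.CriticalPhenomena.PercolationContinuityZ3.Theorems.Transplant.SkelFrmBChoiceAtQV
import Summits.CriticalPhenomena.PercolationContinuityZ3.Theorems.Transplant.SkelFrmBChoiceRoomsV
import Summits.CriticalPhenomena.PercolationContinuityZ3.Theorems.Transplant.SkelFrmBChoiceNums
import Summits.CriticalPhenomena.PercolationContinuityZ3.Theorems.Transplant.SkelFrmBParamsSchedAT
import Summits.CriticalPhenomena.PercolationContinuityZ3.Theorems.Transplant.SkelFrmBParamsCorrKG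
import Summits.CriticalPhenomena.PercolationContinuityZ3.Theorems.Transplant.SkelPhiCorridorKGBoxes2
import HarnessLib

/-!
((R-45) V PORT of `SkelFrm1ReachRadQUT` (p5-g16 port, p5-g17 verification; rulings lead g12 11:31:15Z, design owner p3-g17 (R-44)/(R-45)): the cell layer `PCells2T` ↦ `PCells2V`
(per-axis ASYMMETRIC transverse room `σ·[−hB, hF]`, PlanarCells2VDefs, hp-8 g42/g43), names per hp-8's renamedV/modmapV + the stmt-g21/g22 V choice layer (forward-room slot `hv`);
cell-free lemmas are NOT re-declared (imported from the S/T originals). Text otherwise verbatim except the across-room reading rows `±2·r⊥ ↦ (−hB du.1 + 1, hF du.1 − 1)`.)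
(J17 / (R-39): the UNION-PRISM twin of the second-axis half of SkelFrm1ReachRadQ — `reachOblAtHNF_frmQ3VR_sndU` over `reachOblAtHNF_frmQ3VD_sndU`
(schedule `kgCorrSchedYU`, PER-REGION reading rows `hPR`); text otherwise verbatim.)
# N2 (frames-only node `SamePDropOfSkeletonFrm₁`, OPEN), (C) column: THE CORRIDOR RESIDUE AT ONE PROBE OF A RUN WITH THE RADIUS ROWS AND THE ENTRANCE
# DEPTH DISCHARGED — `PlanarSkeletonFrm.NegB.reachOblAtHNF_frmQ3VR_fst/_snd` (fibre block of record `SUS ex mx`; J15's exhibited instance)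

Over `reachOblAtHNF_frmQ3VD_fst/_snd` (SkelFrm1ReachRowsQD): at a CHOSEN probe of a RUN of the scheme of record the radii are realised
(`reach_radii_concSG₂NbV`: `rQ α x = rB α v e.2 = E`, `ρ β x du = E − 2`, `rM β (x+du) = F(nQ+1) − Lp`, `nQ α x = nS α v + 1`, `E ≥ E₀ + cOffS·‖x‖₁`,
`E := Erad (gap SUS) 0 (E₀ SUS) (nQ α x)`), the explored neighbours of the fresh world are `E' := E(nS α v)`-deep (`deep_of_run₂bOV`), so with the window
radius `R := E − 3`, the entrance depth `R₀ := E'`, the excess radius `R₁ := Rex E'` (`hR₁_US` at the oriented long map `φL = oriφ Φ.φ (oL …)`, fine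
diameter `50·rmax` through `fine_diam_le_mRS`), the world rows of SkelFrmBChoiceRooms (`Rw := E`, `m′ := 25·rmax`, `ctr := cenS x`) and
`E = E' + gap E'` (`Erad_succ`, `gap' = 0`), every radius/depth/world binder of the D-wrappers is discharged; what remains per probe is the K-G row set +
`N`, THREE FLOORS — (ρ1) `r₀0 RL + 3 ≤ E₀`, (ρ2) `13·(prism box depth) + 4 ≤ E₀`, (ρ3) `∀ k, Rex (E k) + r₀0 RL + 3 ≤ gap (E k)` — the reading/start-box rows
and the budget (stmt-g20's Window/Readings/Len).
builds on p205010 (kernel theorem, internal audit signed; external expert review pending) — nothing in this file uses p205010; nothing here is a claim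
about the open node `SamePDropOfSkeletonFrm₁`.
Lane `prim-bschramm`, seat `prim-bschramm-p5` (gen 16 port, gen 17 verification; (C) lineage); helper file (`--supports stmt-CriticalPhenomena-4575 --as helper`).
[cite: KozmaNitzan2024, §4 Lemma 12 (pp. 23–25), pp. 25–27, p. 30 (Step IV)] [cite: MartineauTassion2017, §4.3 Lemma 4.2]
-/

noncomputable section

open MeasureTheory ProbabilityTheory
open scoped ENNReal Classical

namespace Summit.CriticalPhenomena.PercolationContinuityZ3.Theorems.Transplant

namespace PlanarSkeletonFrm

open Literature.Probability.Percolation Literature.Probability.LatticeModels SimpleGraph GadgetSystem ProbeHistory HSiteScheme Contour KNCells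
open Literature.Probability.Percolation.KozmaNitzan.Cells (oth sgOf)
open KNCells.KSchA KNLevels ChainPlanar ChainPara
open Literature.Barriers.CriticalPhenomena (HasExponentialGrowth graphBall graphBall_mono mem_graphBall_self)
open Skel (ReachOblAtHNF excess)
open SkelI (tanOff)
open SkelConc (Consts)
open BoxProdZ2 (ConcRadiiG)
open TwoAxis.Para (modulus)
open Skelφ (oriφ trφ)
open Skelφ.StepI (DataN DataNS OutNS)
open BoxProdZ2 (Erad nQ nS)

namespace NegB

open Neg

section Rad

variable {κ : Consts} {V : Type} [DecidableEq V] [Countable V] {G : SimpleGraph V} [G.LocallyFinite] {Φ : PlanarSkeletonFrm G} {t : V} {p : unitInterval}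
  {hC : Φ.CylSubcritical p} {gv fv : Neg.FSlot} {Pv : PSlot} {ex mx : GSlot} {cv hv : CSlot} {bv : BSlot} {O : OutNS V} {q : unitInterval}


set_option maxHeartbeats 800000 in
/-- **THE (C) RESIDUE OF THE CHOICE FUNCTION OF RECORD AT ONE PROBE OF A RUN, SECOND AXIS, RADII AND DEPTH DISCHARGED** (fibre block `SUS ex mx`):
window radius `R := E(nQ α x) − 3`, entrance depth `R₀ := E(nS α v)` (`deep_of_run₂bOV`), excess radius `R₁ := Rex R₀` (`hR₁_US`), world rows from
SkelFrmBChoiceRooms with `φe :=` the fine map and `m := 50·rmax` (`fine_diam_le_mRS`); left: the K-G row set + `N`, three `E₀`/`gap` floors, the reading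
and start-box rows, the budget. [cite: KozmaNitzan2024, §4 Lemma 12 (pp. 23–25), p. 30 (Step IV)] -/
theorem reachOblAtHNF_frmQ3VR_sndU (hAt : (choiceAtQ3V κ Φ t p Pv gv fv (SUS ex mx) cv hv bv hC).AtQNQ O q) (h1 : Φ.types = {t})
    (hp0 : 0 < (p : ℝ)) (hp1 : (p : ℝ) < 1) (mk : ℕ)
    -- the probe, ON A RUN, CHOSEN
    {h : ProbeHistory V} {e : Site 2 × MDir} (hrun : (((KSchA.mk (ΓQV κ Φ t p O gv fv (SUS ex mx) cv hv bv q) q κ.δ : KSchA V ℕ))).IsRun₂O G h) (hc : ((((KSchA.mk (ΓQV κ Φ t p O gv fv (SUS ex mx) cv hv bv q) q κ.δ : KSchA V ℕ))).astOf₂O G h).st.ochoice KSchA.qNE = some e)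
    (hV : (((KSchA.mk (ΓQV κ Φ t p O gv fv (SUS ex mx) cv hv bv q) q κ.δ : KSchA V ℕ))).Valid₂O G h e) (hdu : ((((1 : Fin 2), true) : MDir)) ∈ (((KSchA.mk (ΓQV κ Φ t p O gv fv (SUS ex mx) cv hv bv q) q κ.δ : KSchA V ℕ))).onwardO G h (tgt e)) (hne : ((((1 : Fin 2), true) : MDir)) ≠ rev e.2)
    -- the corridor of record
    {ρ qq W : ℕ} (HK : Skelφ.KGYRows (nL κ Φ t p O.merged (gOf κ Φ t p O gv) (fOf κ Φ t p O fv)) (ℓL κ Φ t p O.merged (gOf κ Φ t p O gv) (fOf κ Φ t p O fv)) (hL κ Φ t p O.merged (gOf κ Φ t p O gv) (fOf κ Φ t p O fv)) (vL κ Φ t p O.merged (gOf κ Φ t p O gv) (fOf κ Φ t p O fv)) (KS0.R'0 κ Φ t p O.merged mk) ρ qq W) (N : ℕ)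
    -- THE THREE RADIUS FLOORS (ρ1) kit threshold, (ρ2) prism depth, (ρ3) excess inside one gap
    (hρ1 : KS0.r₀0 t O.merged mk (RL κ Φ t p O gv fv) + 3 ≤ Skelφ.Prm.E₀ (SUS ex mx κ Φ t p O.merged (gOf κ Φ t p O gv) (fOf κ Φ t p O fv) q))
    (hρ2 : (13 : ℤ) * (((N : ℤ) + 1) * (((nL κ Φ t p O.merged (gOf κ Φ t p O gv) (fOf κ Φ t p O fv)) * (ℓL κ Φ t p O.merged (gOf κ Φ t p O gv) (fOf κ Φ t p O fv)) / Skelφ.shearUnit (nL κ Φ t p O.merged (gOf κ Φ t p O gv) (fOf κ Φ t p O fv)) (hL κ Φ t p O.merged (gOf κ Φ t p O gv) (fOf κ Φ t p O fv)) + 1 : ℕ) : ℤ) + Skelφ.kgZY₀ (nL κ Φ t p O.merged (gOf κ Φ t p O gv) (fOf κ Φ t p O fv)) (vL κ Φ t p O.merged (gOf κ Φ t p O gv) (fOf κ Φ t p O fv)) (KS0.R'0 κ Φ t p O.merged mk) ρ W N (Skelφ.kgM₁Y (nL κ Φ t p O.merged (gOf κ Φ t p O gv) (fOf κ Φ t p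 O fv)) (vL κ Φ t p O.merged (gOf κ Φ t p O gv) (fOf κ Φ t p O fv)) (KS0.R'0 κ Φ t p O.merged mk) ρ W N) (Skelφ.kgWm₂Y (nL κ Φ t p O.merged (gOf κ Φ t p O gv) (fOf κ Φ t p O fv)) (vL κ Φ t p O.merged (gOf κ Φ t p O gv) (fOf κ Φ t p O fv)) (KS0.R'0 κ Φ t p O.merged mk) ρ W N) (Skelφ.kgWp₂Y (nL κ Φ t p O.merged (gOf κ Φ t p O gv) (fOf κ Φ t p O fv)) (vL κ Φ t p O.merged (gOf κ Φ t p O gv) (fOf κ Φ t p O fv)) (KS0.R'0 κ Φ t p O.merged mk) ρ W N) (Skelφ.kgM₂Y (nL κ Φ t p O.merged (gOf κ Φ t p O gv) (fOf κ Φ t p O fv)) (ℓL κ Φ t p O.merged (gOf κ Φ t p O gv) (fOf κ Φ t p O fv)) (hL κ Φ t p O.merged (gOf κ Φ t p O gv) (fOf κ Φ t p O fv)) (vL κ Φ t p O.merged (gOf κ Φ t p O gv) (fOf κ Φ t p O fv)) (KS0.R'0 κ Φ t p O.merged mk) ρ qq W N) + Skelφ.kgZY₁ (nL κ Φ t p O.merged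 (gOf κ Φ t p O gv) (fOf κ Φ t p O fv)) (ℓL κ Φ t p O.merged (gOf κ Φ t p O gv) (fOf κ Φ t p O fv)) (hL κ Φ t p O.merged (gOf κ Φ t p O gv) (fOf κ Φ t p O fv)) (KS0.R'0 κ Φ t p O.merged mk) ρ qq N (Skelφ.kgM₁Y (nL κ Φ t p O.merged (gOf κ Φ t p O gv) (fOf κ Φ t p O fv)) (vL κ Φ t p O.merged (gOf κ Φ t p O gv) (fOf κ Φ t p O fv)) (KS0.R'0 κ Φ t p O.merged mk) ρ W N) (Skelφ.kgM₂Y (nL κ Φ t p O.merged (gOf κ Φ t p O gv) (fOf κ Φ t p O fv)) (ℓL κ Φ t p O.merged (gOf κ Φ t p O gv) (fOf κ Φ t p O fv)) (hL κ Φ t p O.merged (gOf κ Φ t p O gv) (fOf κ Φ t p O fv)) (vL κ Φ t p O.merged (gOf κ Φ t p O gv) (fOf κ Φ t p O fv)) (KS0.R'0 κ Φ t p O.merged mk) ρ qq W N)) + 4 ≤ (Skelφ.Prm.E₀ (SUS ex mx κ Φ t p O.merged (gOf κ Φ t p O gv) (fOf κ Φ t p O fv) q) : ℤ))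
    (hρ3 : ∀ k : ℕ, (SUS ex mx κ Φ t p O.merged (gOf κ Φ t p O gv) (fOf κ Φ t p O fv) q).Rex (Erad (Skelφ.Prm.gap (SUS ex mx κ Φ t p O.merged (gOf κ Φ t p O gv) (fOf κ Φ t p O fv) q)) (fun _ => 0) (Skelφ.Prm.E₀ (SUS ex mx κ Φ t p O.merged (gOf κ Φ t p O gv) (fOf κ Φ t p O fv) q)) k) + KS0.r₀0 t O.merged mk (RL κ Φ t p O gv fv) + 3 ≤
      Skelφ.Prm.gap (SUS ex mx κ Φ t p O.merged (gOf κ Φ t p O gv) (fOf κ Φ t p O fv) q) (Erad (Skelφ.Prm.gap (SUS ex mx κ Φ t p O.merged (gOf κ Φ t p O gv) (fOf κ Φ t p O fv) q)) (fun _ => 0) (Skelφ.Prm.E₀ (SUS ex mx κ Φ t p O.merged (gOf κ Φ t p O gv) (fOf κ Φ t p O fv) q)) k))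
    -- PER-REGION READING ROWS of the second-axis corridor (J17)
    (hPR : ∀ k ≤ (Skelφ.kgCorrSchedY HK.hn HK.hv HK.hlay (HK.kgYVals_ok₁ N) (HK.kgYVals_ok₂ N) (HK.kgYVals_split N)).N, ∃ lo hi : Site 2,
      (Skelφ.kgCorrSchedY HK.hn HK.hv HK.hlay (HK.kgYVals_ok₁ N) (HK.kgYVals_ok₂ N) (HK.kgYVals_split N)).region k ⊆ Finset.Icc lo hi ∧
      (-(5 * (((fcellsV κ Φ t p O.merged (gOf κ Φ t p O gv) (fOf κ Φ t p O fv) (cOf κ Φ t p O gv fv cv) (hOf κ Φ t p O gv fv hv))).r 1 : ℤ)) + 1 ≤ Skelφ.rdLo ((prFA κ Φ t p O.merged (gOf κ Φ t p O gv) (fOf κ Φ t p O fv))).A (nL κ Φ t p O.merged (gOf κ Φ t p O gv) (fOf κ Φ t p O fv)) (hL κ Φ t p O.merged (gOf κ Φ t p O gv) (fOf κ Φ t p O fv)) (vL κ Φ t p O.merged (gOf κ Φ t p O gv) (fOf κ Φ t p O fv)) (vβL κ Φ t p O.merged (gOf κ Φ t p O gv) (fOf κ Φ t p O fv)) ((prFA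 κ Φ t p O.merged (gOf κ Φ t p O gv) (fOf κ Φ t p O fv))).c₀ ((prFA κ Φ t p O.merged (gOf κ Φ t p O gv) (fOf κ Φ t p O fv))).c₁ ((prFA κ Φ t p O.merged (gOf κ Φ t p O gv) (fOf κ Φ t p O fv))).D lo hi 1 ∧
        Skelφ.rdHi ((prFA κ Φ t p O.merged (gOf κ Φ t p O gv) (fOf κ Φ t p O fv))).A (nL κ Φ t p O.merged (gOf κ Φ t p O gv) (fOf κ Φ t p O fv)) (hL κ Φ t p O.merged (gOf κ Φ t p O gv) (fOf κ Φ t p O fv)) (vL κ Φ t p O.merged (gOf κ Φ t p O gv) (fOf κ Φ t p O fv)) (vβL κ Φ t p O.merged (gOf κ Φ t p O gv) (fOf κ Φ t p O fv)) ((prFA κ Φ t p O.merged (gOf κ Φ t p O gv) (fOf κ Φ t p O fv))).c₀ ((prFA κ Φ t p O.merged (gOf κ Φ t p O gv) (fOf κ Φ t p O fv))).c₁ ((prFA κ Φ t p O.merged (gOf κ Φ t p O gv) (fOf κ Φ t p O fv))).D lo hi 1 ≤ 22 * (((fcellsV κ Φ t p O.merged (gOf κ Φ t p O gv) (fOf κ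 Φ t p O fv) (cOf κ Φ t p O gv fv cv) (hOf κ Φ t p O gv fv hv))).r 1 : ℤ) - 1) ∧
      (-(((fcellsV κ Φ t p O.merged (gOf κ Φ t p O gv) (fOf κ Φ t p O fv) (cOf κ Φ t p O gv fv cv) (hOf κ Φ t p O gv fv hv))).hB 1 : ℤ) + 1 ≤ Skelφ.rdLo ((prFA κ Φ t p O.merged (gOf κ Φ t p O gv) (fOf κ Φ t p O fv))).A (nL κ Φ t p O.merged (gOf κ Φ t p O gv) (fOf κ Φ t p O fv)) (hL κ Φ t p O.merged (gOf κ Φ t p O gv) (fOf κ Φ t p O fv)) (vL κ Φ t p O.merged (gOf κ Φ t p O gv) (fOf κ Φ t p O fv)) (vβL κ Φ t p O.merged (gOf κ Φ t p O gv) (fOf κ Φ t p O fv)) ((prFA κ Φ t p O.merged (gOf κ Φ t p O gv) (fOf κ Φ t p O fv))).c₀ ((prFA κ Φ t p O.merged (gOf κ Φ t p O gv) (fOf κ Φ t p O fv))).c₁ ((prFA κ Φ t p O.merged (gOf κ Φ t p O gv) (fOf κ Φ t p O fv))).D lo hi 0 ∧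
        Skelφ.rdHi ((prFA κ Φ t p O.merged (gOf κ Φ t p O gv) (fOf κ Φ t p O fv))).A (nL κ Φ t p O.merged (gOf κ Φ t p O gv) (fOf κ Φ t p O fv)) (hL κ Φ t p O.merged (gOf κ Φ t p O gv) (fOf κ Φ t p O fv)) (vL κ Φ t p O.merged (gOf κ Φ t p O gv) (fOf κ Φ t p O fv)) (vβL κ Φ t p O.merged (gOf κ Φ t p O gv) (fOf κ Φ t p O fv)) ((prFA κ Φ t p O.merged (gOf κ Φ t p O gv) (fOf κ Φ t p O fv))).c₀ ((prFA κ Φ t p O.merged (gOf κ Φ t p O gv) (fOf κ Φ t p O fv))).c₁ ((prFA κ Φ t p O.merged (gOf κ Φ t p O gv) (fOf κ Φ t p O fv))).D lo hi 0 ≤ (((fcellsV κ Φ t p O.merged (gOf κ Φ t p O gv) (fOf κ Φ t p O fv) (cOf κ Φ t p O gv fv cv) (hOf κ Φ t p O gv fv hv))).hF 1 : ℤ) - 1))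
    -- READING ROWS of the arrival box `[kgLastLoY, kgLastHiY]` (SkelPhiCorridorKGBoxes)
    (hLl : 20 * (((fcellsV κ Φ t p O.merged (gOf κ Φ t p O gv) (fOf κ Φ t p O fv) (cOf κ Φ t p O gv fv cv) (hOf κ Φ t p O gv fv hv))).r 1 : ℤ) - (bOf κ Φ t p O gv fv bv) 1 + 1 ≤ Skelφ.rdLo ((prFA κ Φ t p O.merged (gOf κ Φ t p O gv) (fOf κ Φ t p O fv))).A (nL κ Φ t p O.merged (gOf κ Φ t p O gv) (fOf κ Φ t p O fv)) (hL κ Φ t p O.merged (gOf κ Φ t p O gv) (fOf κ Φ t p O fv)) (vL κ Φ t p O.merged (gOf κ Φ t p O gv) (fOf κ Φ t p O fv)) (vβL κ Φ t p O.merged (gOf κ Φ t p O gv) (fOf κ Φ t p O fv)) ((prFA κ Φ t p O.merged (gOf κ Φ t p O gv) (fOf κ Φ t p O fv))).c₀ ((prFA κ Φ t p O.merged (gOf κ Φ t p O gv) (fOf κ Φ t p O fv))).c₁ ((prFA κ Φ t p O.merged (gOf κ Φ t p O gv) (fOf κ Φ t p O fv))).D (HK.kgLastLoY N) (HK.kgLastHiY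 N) 1 ∧
      5 * (((fcellsV κ Φ t p O.merged (gOf κ Φ t p O gv) (fOf κ Φ t p O fv) (cOf κ Φ t p O gv fv cv) (hOf κ Φ t p O gv fv hv))).r 1 : ℤ) ≤ Skelφ.rdLo ((prFA κ Φ t p O.merged (gOf κ Φ t p O gv) (fOf κ Φ t p O fv))).A (nL κ Φ t p O.merged (gOf κ Φ t p O gv) (fOf κ Φ t p O fv)) (hL κ Φ t p O.merged (gOf κ Φ t p O gv) (fOf κ Φ t p O fv)) (vL κ Φ t p O.merged (gOf κ Φ t p O gv) (fOf κ Φ t p O fv)) (vβL κ Φ t p O.merged (gOf κ Φ t p O gv) (fOf κ Φ t p O fv)) ((prFA κ Φ t p O.merged (gOf κ Φ t p O gv) (fOf κ Φ t p O fv))).c₀ ((prFA κ Φ t p O.merged (gOf κ Φ t p O gv) (fOf κ Φ t p O fv))).c₁ ((prFA κ Φ t p O.merged (gOf κ Φ t p O gv) (fOf κ Φ t p O fv))).D (HK.kgLastLoY N) (HK.kgLastHiY N) 1 ∧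
      Skelφ.rdHi ((prFA κ Φ t p O.merged (gOf κ Φ t p O gv) (fOf κ Φ t p O fv))).A (nL κ Φ t p O.merged (gOf κ Φ t p O gv) (fOf κ Φ t p O fv)) (hL κ Φ t p O.merged (gOf κ Φ t p O gv) (fOf κ Φ t p O fv)) (vL κ Φ t p O.merged (gOf κ Φ t p O gv) (fOf κ Φ t p O fv)) (vβL κ Φ t p O.merged (gOf κ Φ t p O gv) (fOf κ Φ t p O fv)) ((prFA κ Φ t p O.merged (gOf κ Φ t p O gv) (fOf κ Φ t p O fv))).c₀ ((prFA κ Φ t p O.merged (gOf κ Φ t p O gv) (fOf κ Φ t p O fv))).c₁ ((prFA κ Φ t p O.merged (gOf κ Φ t p O gv) (fOf κ Φ t p O fv))).D (HK.kgLastLoY N) (HK.kgLastHiY N) 1 ≤ 20 * (((fcellsV κ Φ t p O.merged (gOf κ Φ t p O gv) (fOf κ Φ t p O fv) (cOf κ Φ t p O gv fv cv) (hOf κ Φ t p O gv fv hv))).r 1 : ℤ) + (bOf κ Φ t p O gv fv bv) 1 - 1 ∧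
      Skelφ.rdHi ((prFA κ Φ t p O.merged (gOf κ Φ t p O gv) (fOf κ Φ t p O fv))).A (nL κ Φ t p O.merged (gOf κ Φ t p O gv) (fOf κ Φ t p O fv)) (hL κ Φ t p O.merged (gOf κ Φ t p O gv) (fOf κ Φ t p O fv)) (vL κ Φ t p O.merged (gOf κ Φ t p O gv) (fOf κ Φ t p O fv)) (vβL κ Φ t p O.merged (gOf κ Φ t p O gv) (fOf κ Φ t p O fv)) ((prFA κ Φ t p O.merged (gOf κ Φ t p O gv) (fOf κ Φ t p O fv))).c₀ ((prFA κ Φ t p O.merged (gOf κ Φ t p O gv) (fOf κ Φ t p O fv))).c₁ ((prFA κ Φ t p O.merged (gOf κ Φ t p O gv) (fOf κ Φ t p O fv))).D (HK.kgLastLoY N) (HK.kgLastHiY N) 1 ≤ 22 * (((fcellsV κ Φ t p O.merged (gOf κ Φ t p O gv) (fOf κ Φ t p O fv) (cOf κ Φ t p O gv fv cv) (hOf κ Φ t p O gv fv hv))).r 1 : ℤ))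
    (hLt : ((fcellsV κ Φ t p O.merged (gOf κ Φ t p O gv) (fOf κ Φ t p O fv) (cOf κ Φ t p O gv fv cv) (hOf κ Φ t p O gv fv hv))).cenS (tgt e + stepVec ((((1 : Fin 2), true) : MDir))) 0 - ((fcellsV κ Φ t p O.merged (gOf κ Φ t p O gv) (fOf κ Φ t p O fv) (cOf κ Φ t p O gv fv cv) (hOf κ Φ t p O gv fv hv))).cenS (tgt e) 0 - (bOf κ Φ t p O gv fv bv) 0 + 1 ≤ Skelφ.rdLo ((prFA κ Φ t p O.merged (gOf κ Φ t p O gv) (fOf κ Φ t p O fv))).A (nL κ Φ t p O.merged (gOf κ Φ t p O gv) (fOf κ Φ t p O fv)) (hL κ Φ t p O.merged (gOf κ Φ t p O gv) (fOf κ Φ t p O fv)) (vL κ Φ t p O.merged (gOf κ Φ t p O gv) (fOf κ Φ t p O fv)) (vβL κ Φ t p O.merged (gOf κ Φ t p O gv) (fOf κ Φ t p O fv)) ((prFA κ Φ t p O.merged (gOf κ Φ t p O gv) (fOf κ Φ t p O fv))).c₀ ((prFA κ Φ t p O.merged (gOf κ Φ t p O gv) (fOf κ Φ t p O fv))).c₁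 ((prFA κ Φ t p O.merged (gOf κ Φ t p O gv) (fOf κ Φ t p O fv))).D (HK.kgLastLoY N) (HK.kgLastHiY N) 0 ∧
      Skelφ.rdHi ((prFA κ Φ t p O.merged (gOf κ Φ t p O gv) (fOf κ Φ t p O fv))).A (nL κ Φ t p O.merged (gOf κ Φ t p O gv) (fOf κ Φ t p O fv)) (hL κ Φ t p O.merged (gOf κ Φ t p O gv) (fOf κ Φ t p O fv)) (vL κ Φ t p O.merged (gOf κ Φ t p O gv) (fOf κ Φ t p O fv)) (vβL κ Φ t p O.merged (gOf κ Φ t p O gv) (fOf κ Φ t p O fv)) ((prFA κ Φ t p O.merged (gOf κ Φ t p O gv) (fOf κ Φ t p O fv))).c₀ ((prFA κ Φ t p O.merged (gOf κ Φ t p O gv) (fOf κ Φ t p O fv))).c₁ ((prFA κ Φ t p O.merged (gOf κ Φ t p O gv) (fOf κ Φ t p O fv))).D (HK.kgLastLoY N) (HK.kgLastHiY N) 0 ≤ ((fcellsV κ Φ t p O.merged (gOf κ Φ t p O gv) (fOf κ Φ t p O fv) (cOf κ Φ t p O gv fv cv) (hOf κ Φ t p O gv fv hv))).cenS (tgt e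 + stepVec ((((1 : Fin 2), true) : MDir))) 0 - ((fcellsV κ Φ t p O.merged (gOf κ Φ t p O gv) (fOf κ Φ t p O fv) (cOf κ Φ t p O gv fv cv) (hOf κ Φ t p O gv fv hv))).cenS (tgt e) 0 + (bOf κ Φ t p O gv fv bv) 0 - 1 ∧
      -(((fcellsV κ Φ t p O.merged (gOf κ Φ t p O gv) (fOf κ Φ t p O fv) (cOf κ Φ t p O gv fv cv) (hOf κ Φ t p O gv fv hv))).hB 1 : ℤ) ≤ Skelφ.rdLo ((prFA κ Φ t p O.merged (gOf κ Φ t p O gv) (fOf κ Φ t p O fv))).A (nL κ Φ t p O.merged (gOf κ Φ t p O gv) (fOf κ Φ t p O fv)) (hL κ Φ t p O.merged (gOf κ Φ t p O gv) (fOf κ Φ t p O fv)) (vL κ Φ t p O.merged (gOf κ Φ t p O gv) (fOf κ Φ t p O fv)) (vβL κ Φ t p O.merged (gOf κ Φ t p O gv) (fOf κ Φ t p O fv)) ((prFA κ Φ t p O.merged (gOf κ Φ t p O gv) (fOf κ Φ t p O fv))).c₀ ((prFA κ Φ t p O.merged (gOf κ Φ t p O gv) (fOf κ Φ t p O fv))).c₁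 ((prFA κ Φ t p O.merged (gOf κ Φ t p O gv) (fOf κ Φ t p O fv))).D (HK.kgLastLoY N) (HK.kgLastHiY N) 0 ∧
      Skelφ.rdHi ((prFA κ Φ t p O.merged (gOf κ Φ t p O gv) (fOf κ Φ t p O fv))).A (nL κ Φ t p O.merged (gOf κ Φ t p O gv) (fOf κ Φ t p O fv)) (hL κ Φ t p O.merged (gOf κ Φ t p O gv) (fOf κ Φ t p O fv)) (vL κ Φ t p O.merged (gOf κ Φ t p O gv) (fOf κ Φ t p O fv)) (vβL κ Φ t p O.merged (gOf κ Φ t p O gv) (fOf κ Φ t p O fv)) ((prFA κ Φ t p O.merged (gOf κ Φ t p O gv) (fOf κ Φ t p O fv))).c₀ ((prFA κ Φ t p O.merged (gOf κ Φ t p O gv) (fOf κ Φ t p O fv))).c₁ ((prFA κ Φ t p O.merged (gOf κ Φ t p O gv) (fOf κ Φ t p O fv))).D (HK.kgLastLoY N) (HK.kgLastHiY N) 0 ≤ (((fcellsV κ Φ t p O.merged (gOf κ Φ t p O gv) (fOf κ Φ t p O fv) (cOf κ Φ t p O gv fv cv) (hOf κ Φ t p O gv fv hv))).hF 1 : ℤ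))
    -- START-BOX ROWS (`aW ≤ (n ± v) + W`, `bL ≤ qq`)
    {aW Bx bL : ℤ} (ha : ((prFA κ Φ t p O.merged (gOf κ Φ t p O gv) (fOf κ Φ t p O fv))).D * (((prFA κ Φ t p O.merged (gOf κ Φ t p O gv) (fOf κ Φ t p O fv))).c₁ * ((nL κ Φ t p O.merged (gOf κ Φ t p O gv) (fOf κ Φ t p O fv)) : ℤ) * ((bOf κ Φ t p O gv fv bv) 0 + 1) + ((prFA κ Φ t p O.merged (gOf κ Φ t p O gv) (fOf κ Φ t p O fv))).c₀ * |(vL κ Φ t p O.merged (gOf κ Φ t p O gv) (fOf κ Φ t p O fv))| * ((bOf κ Φ t p O gv fv bv) 1 + 1)) ≤ ((prFA κ Φ t p O.merged (gOf κ Φ t p O gv) (fOf κ Φ t p O fv))).c₀ * ((prFA κ Φ t p O.merged (gOf κ Φ t p O gv) (fOf κ Φ t p O fv))).c₁ * ((prFA κ Φ t p O.merged (gOf κ Φ t p O gv) (fOf κ Φ t p O fv))).A * modulus (nL κ Φ t p O.merged (gOf κ Φ t p O gv) (fOf κ Φ t p O fv)) (hL κ Φ t p O.merged (gOf κ Φ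 t p O gv) (fOf κ Φ t p O fv)) (vL κ Φ t p O.merged (gOf κ Φ t p O gv) (fOf κ Φ t p O fv)) (vβL κ Φ t p O.merged (gOf κ Φ t p O gv) (fOf κ Φ t p O fv)) * aW)
    (hBx : ((prFA κ Φ t p O.merged (gOf κ Φ t p O gv) (fOf κ Φ t p O fv))).D * (((bOf κ Φ t p O gv fv bv) 1 : ℤ) + 1) ≤ ((prFA κ Φ t p O.merged (gOf κ Φ t p O gv) (fOf κ Φ t p O fv))).c₁ * ((prFA κ Φ t p O.merged (gOf κ Φ t p O gv) (fOf κ Φ t p O fv))).A * Bx) (hbL : Bx / (Skelφ.shearUnit (nL κ Φ t p O.merged (gOf κ Φ t p O gv) (fOf κ Φ t p O fv)) (hL κ Φ t p O.merged (gOf κ Φ t p O gv) (fOf κ Φ t p O fv)) : ℤ) + 1 ≤ bL)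
    (haW : aW ≤ (((((nL κ Φ t p O.merged (gOf κ Φ t p O gv) (fOf κ Φ t p O fv)) : ℤ) + (vL κ Φ t p O.merged (gOf κ Φ t p O gv) (fOf κ Φ t p O fv))).toNat + W : ℕ) : ℤ)) (haW' : aW ≤ (((((nL κ Φ t p O.merged (gOf κ Φ t p O gv) (fOf κ Φ t p O fv)) : ℤ) - (vL κ Φ t p O.merged (gOf κ Φ t p O gv) (fOf κ Φ t p O fv))).toNat + W : ℕ) : ℤ)) (hbq : bL ≤ qq)
    -- the budget
    {nmax : ℕ} (hnmax : (Skelφ.kgCorrSchedYU HK.hn HK.hv HK.hlay (HK.kgYVals_ok₁ N) (HK.kgYVals_ok₂ N) (HK.kgYVals_split N)).N ≤ nmax) :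
    ReachOblAtHNF G nmax ((KSchA.mk (ΓQV κ Φ t p O gv fv (SUS ex mx) cv hv bv q) q κ.δ : KSchA V ℕ)) (FDQV κ Φ t p O gv fv (SUS ex mx) cv hv q) Φ.Δ (κ.δr 0) h e ((((KSchA.mk (ΓQV κ Φ t p O gv fv (SUS ex mx) cv hv bv q) q κ.δ : KSchA V ℕ))).aOf₂O G h e) ((((1 : Fin 2), true) : MDir)) := by
  obtain ⟨ω, n, rfl⟩ := hrun
  -- the long clause and its numerics
  have hN := eqNumL_of_atQV hAt
  obtain ⟨hn1, hℓ1⟩ := one_le_of_eqNumL κ Φ t p O.merged (gOf κ Φ t p O gv) (fOf κ Φ t p O fv) hN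
  have hκL := (clauseL_of_atQV hAt).2
  obtain ⟨-, -, -, hCq⟩ := factsNS_of_atQV hAt
  have hlipφ := lip_φL κ Φ t p O.D O.DT.toDataN O.ori (gOf κ Φ t p O gv) (fOf κ Φ t p O fv)
  have hstep := steps_φL κ Φ t p O.D O.DT.toDataN O.ori (gOf κ Φ t p O gv) (fOf κ Φ t p O fv)
  have hlipψ : Skelφ.Lip G (fineOA κ Φ t p O.D O.DT.toDataN O.ori (gOf κ Φ t p O gv) (fOf κ Φ t p O fv)) := lip_fineA_at κ Φ t p O.merged (gOf κ Φ t p O gv) (fOf κ Φ t p O fv) hlipφ hN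
  have hwsψ : Skelφ.WeakSteps G (fineOA κ Φ t p O.D O.DT.toDataN O.ori (gOf κ Φ t p O gv) (fOf κ Φ t p O fv)) := weakSteps_fineA_at κ Φ t p O.merged (gOf κ Φ t p O gv) (fOf κ Φ t p O fv) hstep hN
  have hψ0 : (fineOA κ Φ t p O.D O.DT.toDataN O.ori (gOf κ Φ t p O gv) (fOf κ Φ t p O fv)) t = 0 := fineA_base_at κ Φ t p O.merged (gOf κ Φ t p O gv) (fOf κ Φ t p O fv) _ hN
  have hΛ : Skelφ.WFS2 ((fcellsV κ Φ t p O.merged (gOf κ Φ t p O gv) (fOf κ Φ t p O fv) (cOf κ Φ t p O gv fv cv) (hOf κ Φ t p O gv fv hv))).toPCells2 (schedOfT κ Φ t p O.merged (gOf κ Φ t p O gv) (fOf κ Φ t p O fv) (cOf κ Φ t p O gv fv cv) (SUS ex mx κ Φ t p O.merged (gOf κ Φ t p O gv) (fOf κ Φ t p O fv) q)) := schedOfT_WFS2 κ Φ t p O.merged (gOf κ Φ t p O gv) (fOf κ Φ t p O fv) (cOf κ Φ t p O gv fv cv) (SUS ex mx κ Φ t p O.merged (gOf κ Φ t p O gv)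 (fOf κ Φ t p O fv) q)
  have hcolQ : ∀ a x, ∃ y ∈ Skelφ.VWin G (fineOA κ Φ t p O.D O.DT.toDataN O.ori (gOf κ Φ t p O gv) (fOf κ Φ t p O fv)) t (((fcellsV κ Φ t p O.merged (gOf κ Φ t p O gv) (fOf κ Φ t p O fv) (cOf κ Φ t p O gv fv cv) (hOf κ Φ t p O gv fv hv))).Q x) (((schedOfT κ Φ t p O.merged (gOf κ Φ t p O gv) (fOf κ Φ t p O fv) (cOf κ Φ t p O gv fv cv) (SUS ex mx κ Φ t p O.merged (gOf κ Φ t p O gv) (fOf κ Φ t p O fv) q))).rQ a x), (fineOA κ Φ t p O.D O.DT.toDataN O.ori (gOf κ Φ t p O gv) (fOf κ Φ t p O fv)) y = ((fcellsV κ Φ t p O.merged (gOf κ Φ t p O gv) (fOf κ Φ t p O fv) (cOf κ Φ t p O gv fv cv) (hOf κ Φ t p O gv fv hv))).cenS x :=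
    hcol_fineA_of_schedV κ Φ t p O.merged (gOf κ Φ t p O gv) (fOf κ Φ t p O fv) (cOf κ Φ t p O gv fv cv) (hOf κ Φ t p O gv fv hv) hlipφ hstep hN (colQ_schedOfT κ Φ t p O.merged (gOf κ Φ t p O gv) (fOf κ Φ t p O fv) (cOf κ Φ t p O gv fv cv) (SUS ex mx κ Φ t p O.merged (gOf κ Φ t p O gv) (fOf κ Φ t p O fv) q))
  have hgap := hgap20_US κ Φ t p O.merged (gOf κ Φ t p O gv) (fOf κ Φ t p O fv) ex mx q
  have hgapc := hgapc_US κ Φ t p O.merged (gOf κ Φ t p O gv) (fOf κ Φ t p O fv) ex mx q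
  have hgapL := hgapL_US κ Φ t p O.merged (gOf κ Φ t p O gv) (fOf κ Φ t p O fv) ex mx q
  have hoff := offNT_le κ Φ t p O.merged (gOf κ Φ t p O gv) (fOf κ Φ t p O fv) (cOf κ Φ t p O gv fv cv) hN hκL
  have hE3 := (three_le_E₀_US κ Φ t p O.merged (gOf κ Φ t p O gv) (fOf κ Φ t p O fv) ex mx q).1
  have hc' : (((((KSchA.mk (ΓQV κ Φ t p O gv fv (SUS ex mx) cv hv bv q) q κ.δ : KSchA V ℕ))).scheme₂O G).ostN KSchA.qNE n ω).ochoice KSchA.qNE = some e := by rw [KSchA.stN_eq₂O]; exact hc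
  -- THE RADII AT THE PROBE (realised anchors)
  obtain ⟨hrQ, hrB, hρ, -, hrM, hQS, hxn⟩ := Skelφ.reach_radii_concSG₂NbV (ψ := (fineOA κ Φ t p O.D O.DT.toDataN O.ori (gOf κ Φ t p O gv) (fOf κ Φ t p O fv))) (P := (fcellsV κ Φ t p O.merged (gOf κ Φ t p O gv) (fOf κ Φ t p O fv) (cOf κ Φ t p O gv fv cv) (hOf κ Φ t p O gv fv hv))) (t := t) (gap := Skelφ.Prm.gap (SUS ex mx κ Φ t p O.merged (gOf κ Φ t p O gv) (fOf κ Φ t p O fv) q)) (gap' := fun _ => 0)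
    (E₀ := Skelφ.Prm.E₀ (SUS ex mx κ Φ t p O.merged (gOf κ Φ t p O gv) (fOf κ Φ t p O fv) q)) (L' := Skelφ.Prm.Lp (SUS ex mx κ Φ t p O.merged (gOf κ Φ t p O gv) (fOf κ Φ t p O fv) q)) (off := offNT κ Φ t p O.merged (gOf κ Φ t p O gv) (fOf κ Φ t p O fv) (cOf κ Φ t p O gv fv cv)) (b₀ := (bOf κ Φ t p O gv fv bv)) (q := q) (δc := κ.δ)
    hgap hgapc hoff (by omega) hψ0 hc hV hdu
  obtain ⟨hDQ, hDρ', hρM, hlin⟩ := Skelφ.reach_radius_rows_concSG₂NbV (ψ := (fineOA κ Φ t p O.D O.DT.toDataN O.ori (gOf κ Φ t p O gv) (fOf κ Φ t p O fv))) (P := (fcellsV κ Φ t p O.merged (gOf κ Φ t p O gv) (fOf κ Φ t p O fv) (cOf κ Φ t p O gv fv cv) (hOf κ Φ t p O gv fv hv))) (t := t) (gap := Skelφ.Prm.gap (SUS ex mx κ Φ t p O.merged (gOf κ Φ t p O gv) (fOf κ Φ t p O fv) q))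
    (E₀ := Skelφ.Prm.E₀ (SUS ex mx κ Φ t p O.merged (gOf κ Φ t p O gv) (fOf κ Φ t p O fv) q)) (L' := Skelφ.Prm.Lp (SUS ex mx κ Φ t p O.merged (gOf κ Φ t p O gv) (fOf κ Φ t p O fv) q)) (off := offNT κ Φ t p O.merged (gOf κ Φ t p O gv) (fOf κ Φ t p O fv) (cOf κ Φ t p O gv fv cv)) (b₀ := (bOf κ Φ t p O gv fv bv)) (q := q) (δc := κ.δ)
    hgap hgapc hgapL hoff hE3 hψ0 hc hV hdu
  -- THE ENTRANCE DEPTH ALONG THE RUN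
  have hdeep := Skelφ.deep_of_run₂bOV hlipψ hwsψ (fcellsV κ Φ t p O.merged (gOf κ Φ t p O gv) (fOf κ Φ t p O fv) (cOf κ Φ t p O gv fv cv) (hOf κ Φ t p O gv fv hv)) t (Skelφ.Prm.gap (SUS ex mx κ Φ t p O.merged (gOf κ Φ t p O gv) (fOf κ Φ t p O fv) q)) (fun _ => 0) (Skelφ.Prm.E₀ (SUS ex mx κ Φ t p O.merged (gOf κ Φ t p O gv) (fOf κ Φ t p O fv) q)) (Skelφ.Prm.Lp (SUS ex mx κ Φ t p O.merged (gOf κ Φ t p O gv) (fOf κ Φ t p O fv) q))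
    (offNT κ Φ t p O.merged (gOf κ Φ t p O gv) (fOf κ Φ t p O fv) (cOf κ Φ t p O gv fv cv)) q κ.δ (bOf κ Φ t p O gv fv bv) hΛ hψ0 hgap hgapc hoff (by omega) hcolQ ω n hc' hdu ((((KSchA.mk (ΓQV κ Φ t p O gv fv (SUS ex mx) cv hv bv q) q κ.δ : KSchA V ℕ))).aOf₂O G ((((KSchA.mk (ΓQV κ Φ t p O gv fv (SUS ex mx) cv hv bv q) q κ.δ : KSchA V ℕ))).hst₂O G ω n) e)
  -- the levels, and the radii facts in the scheme-of-record form (definitional unfoldings of `ΓQV`/`schedOfT`/`FDQV`)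
  set E := Erad (Skelφ.Prm.gap (SUS ex mx κ Φ t p O.merged (gOf κ Φ t p O gv) (fOf κ Φ t p O fv) q)) (fun _ => 0) (Skelφ.Prm.E₀ (SUS ex mx κ Φ t p O.merged (gOf κ Φ t p O gv) (fOf κ Φ t p O fv) q)) (nQ ((((KSchA.mk (ΓQV κ Φ t p O gv fv (SUS ex mx) cv hv bv q) q κ.δ : KSchA V ℕ))).aOf₁O G ((((KSchA.mk (ΓQV κ Φ t p O gv fv (SUS ex mx) cv hv bv q) q κ.δ : KSchA V ℕ))).hst₂O G ω n) e) (tgt e)) with hEdef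
  set E' := Erad (Skelφ.Prm.gap (SUS ex mx κ Φ t p O.merged (gOf κ Φ t p O gv) (fOf κ Φ t p O fv) q)) (fun _ => 0) (Skelφ.Prm.E₀ (SUS ex mx κ Φ t p O.merged (gOf κ Φ t p O gv) (fOf κ Φ t p O fv) q)) (nS ((((KSchA.mk (ΓQV κ Φ t p O gv fv (SUS ex mx) cv hv bv q) q κ.δ : KSchA V ℕ))).aOf₁O G ((((KSchA.mk (ΓQV κ Φ t p O gv fv (SUS ex mx) cv hv bv q) q κ.δ : KSchA V ℕ))).hst₂O G ω n) e) e.1) with hE'def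
  have hEE₀ : Skelφ.Prm.E₀ (SUS ex mx κ Φ t p O.merged (gOf κ Φ t p O gv) (fOf κ Φ t p O fv) q) ≤ E := Skel.E₀_le_Erad _ _ _ _
  have hE'E₀ : Skelφ.Prm.E₀ (SUS ex mx κ Φ t p O.merged (gOf κ Φ t p O gv) (fOf κ Φ t p O fv) q) ≤ E' := Skel.E₀_le_Erad _ _ _ _
  have hrQ' : ((schedOfT κ Φ t p O.merged (gOf κ Φ t p O gv) (fOf κ Φ t p O fv) (cOf κ Φ t p O gv fv cv) (SUS ex mx κ Φ t p O.merged (gOf κ Φ t p O gv) (fOf κ Φ t p O fv) q))).rQ ((((KSchA.mk (ΓQV κ Φ t p O gv fv (SUS ex mx) cv hv bv q) q κ.δ : KSchA V ℕ))).aOf₁O G ((((KSchA.mk (ΓQV κ Φ t p O gv fv (SUS ex mx) cv hv bv q) q κ.δ : KSchA V ℕ))).hst₂O G ω n) e) (tgt e) = E := hrQ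
  have hrB' : ((schedOfT κ Φ t p O.merged (gOf κ Φ t p O gv) (fOf κ Φ t p O fv) (cOf κ Φ t p O gv fv cv) (SUS ex mx κ Φ t p O.merged (gOf κ Φ t p O gv) (fOf κ Φ t p O fv) q))).rB ((((KSchA.mk (ΓQV κ Φ t p O gv fv (SUS ex mx) cv hv bv q) q κ.δ : KSchA V ℕ))).aOf₁O G ((((KSchA.mk (ΓQV κ Φ t p O gv fv (SUS ex mx) cv hv bv q) q κ.δ : KSchA V ℕ))).hst₂O G ω n) e) e.1 e.2 = E := hrB
  have hρ' : ∀ ℓ, ((schedOfT κ Φ t p O.merged (gOf κ Φ t p O gv) (fOf κ Φ t p O fv) (cOf κ Φ t p O gv fv cv) (SUS ex mx κ Φ t p O.merged (gOf κ Φ t p O gv) (fOf κ Φ t p O fv) q))).ρ ((((KSchA.mk (ΓQV κ Φ t p O gv fv (SUS ex mx) cv hv bv q) q κ.δ : KSchA V ℕ))).aOf₂O G ((((KSchA.mk (ΓQV κ Φ t p O gv fv (SUS ex mx) cv hv bv q) q κ.δ : KSchA V ℕ))).hst₂O G ω n) e) (tgt e) ((((1 : Fin 2), true) : MDir)) ℓ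 = E - 2 := hρ
  have hQS' : nQ ((((KSchA.mk (ΓQV κ Φ t p O gv fv (SUS ex mx) cv hv bv q) q κ.δ : KSchA V ℕ))).aOf₁O G ((((KSchA.mk (ΓQV κ Φ t p O gv fv (SUS ex mx) cv hv bv q) q κ.δ : KSchA V ℕ))).hst₂O G ω n) e) (tgt e) = nS ((((KSchA.mk (ΓQV κ Φ t p O gv fv (SUS ex mx) cv hv bv q) q κ.δ : KSchA V ℕ))).aOf₁O G ((((KSchA.mk (ΓQV κ Φ t p O gv fv (SUS ex mx) cv hv bv q) q κ.δ : KSchA V ℕ))).hst₂O G ω n) e) e.1 + 1 := hQS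
  have hlin' : Skelφ.Prm.E₀ (SUS ex mx κ Φ t p O.merged (gOf κ Φ t p O gv) (fOf κ Φ t p O fv) q) + cOffS κ Φ t p O.merged (gOf κ Φ t p O gv) (fOf κ Φ t p O fv) * (((tgt e) 0).natAbs + ((tgt e) 1).natAbs) ≤ E := hlin
  have hDQ' : E - 3 + 1 ≤ ((schedOfT κ Φ t p O.merged (gOf κ Φ t p O gv) (fOf κ Φ t p O fv) (cOf κ Φ t p O gv fv cv) (SUS ex mx κ Φ t p O.merged (gOf κ Φ t p O gv) (fOf κ Φ t p O fv) q))).rQ ((((KSchA.mk (ΓQV κ Φ t p O gv fv (SUS ex mx) cv hv bv q) q κ.δ : KSchA V ℕ))).aOf₁O G ((((KSchA.mk (ΓQV κ Φ t p O gv fv (SUS ex mx) cv hv bv q) q κ.δ : KSchA V ℕ))).hst₂O G ω n) e) (tgt e) := hDQ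
  have hDρ'' : ∀ ℓ, E - 3 + 1 ≤ ((schedOfT κ Φ t p O.merged (gOf κ Φ t p O gv) (fOf κ Φ t p O fv) (cOf κ Φ t p O gv fv cv) (SUS ex mx κ Φ t p O.merged (gOf κ Φ t p O gv) (fOf κ Φ t p O fv) q))).ρ ((((KSchA.mk (ΓQV κ Φ t p O gv fv (SUS ex mx) cv hv bv q) q κ.δ : KSchA V ℕ))).aOf₂O G ((((KSchA.mk (ΓQV κ Φ t p O gv fv (SUS ex mx) cv hv bv q) q κ.δ : KSchA V ℕ))).hst₂O G ω n) e) (tgt e) ((((1 : Fin 2), true) : MDir)) ℓ := hDρ'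
  have hρM' : ∀ ℓ, ((schedOfT κ Φ t p O.merged (gOf κ Φ t p O gv) (fOf κ Φ t p O fv) (cOf κ Φ t p O gv fv cv) (SUS ex mx κ Φ t p O.merged (gOf κ Φ t p O gv) (fOf κ Φ t p O fv) q))).ρ ((((KSchA.mk (ΓQV κ Φ t p O gv fv (SUS ex mx) cv hv bv q) q κ.δ : KSchA V ℕ))).aOf₂O G ((((KSchA.mk (ΓQV κ Φ t p O gv fv (SUS ex mx) cv hv bv q) q κ.δ : KSchA V ℕ))).hst₂O G ω n) e) (tgt e) ((((1 : Fin 2), true) : MDir)) ℓ + 1 ≤ ((schedOfT κ Φ t p O.merged (gOf κ Φ t p O gv) (fOf κ Φ t p O fv) (cOf κ Φ t p O gv fv cv) (SUS ex mx κ Φ t p O.merged (gOf κ Φ t p O gv) (fOf κ Φ t p O fv) q))).rM ((((KSchA.mk (ΓQV κ Φ t p O gv fv (SUS ex mx) cv hv bv q) q κ.δ : KSchA V ℕ))).aOf₂O G ((((KSchA.mk (ΓQV κ Φ t p O gv fv (SUS ex mx) cv hv bv q) q κ.δ : KSchA V ℕ))).hst₂O G ω n) e) (tgt e + stepVec ((((1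 : Fin 2), true) : MDir))) := hρM
  have hdeep' : ∀ a ∈ (((KSchA.mk (ΓQV κ Φ t p O gv fv (SUS ex mx) cv hv bv q) q κ.δ : KSchA V ℕ))).Vx G ((((KSchA.mk (ΓQV κ Φ t p O gv fv (SUS ex mx) cv hv bv q) q κ.δ : KSchA V ℕ))).hst₂O G ω n), ∀ b ∈ (((KSchA.mk (ΓQV κ Φ t p O gv fv (SUS ex mx) cv hv bv q) q κ.δ : KSchA V ℕ))).Γ.Ewv ((((KSchA.mk (ΓQV κ Φ t p O gv fv (SUS ex mx) cv hv bv q) q κ.δ : KSchA V ℕ))).aOf₁O G ((((KSchA.mk (ΓQV κ Φ t p O gv fv (SUS ex mx) cv hv bv q) q κ.δ : KSchA V ℕ))).hst₂O G ω n) e) e.1 e.2 ∪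
      ((FDQV κ Φ t p O gv fv (SUS ex mx) cv hv q)).Hfull ((((KSchA.mk (ΓQV κ Φ t p O gv fv (SUS ex mx) cv hv bv q) q κ.δ : KSchA V ℕ))).aOf₂O G ((((KSchA.mk (ΓQV κ Φ t p O gv fv (SUS ex mx) cv hv bv q) q κ.δ : KSchA V ℕ))).hst₂O G ω n) e) (tgt e) ((((1 : Fin 2), true) : MDir)), b ∉ (((KSchA.mk (ΓQV κ Φ t p O gv fv (SUS ex mx) cv hv bv q) q κ.δ : KSchA V ℕ))).Vx G ((((KSchA.mk (ΓQV κ Φ t p O gv fv (SUS ex mx) cv hv bv q) q κ.δ : KSchA V ℕ))).hst₂O G ω n) → G.Adj a b → a ∈ graphBall G t E' := hdeep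
  have hEsucc : E = E' + Skelφ.Prm.gap (SUS ex mx κ Φ t p O.merged (gOf κ Φ t p O gv) (fOf κ Φ t p O fv) q) E' := by
    rw [hEdef, hQS', BoxProdZ2.Erad_succ, BoxProdZ2.Frad_succ, ← hE'def]; simp
  have hρ3' : (SUS ex mx κ Φ t p O.merged (gOf κ Φ t p O gv) (fOf κ Φ t p O fv) q).Rex E' + KS0.r₀0 t O.merged mk (RL κ Φ t p O gv fv) + 3 ≤ Skelφ.Prm.gap (SUS ex mx κ Φ t p O.merged (gOf κ Φ t p O gv) (fOf κ Φ t p O fv) q) E' := hρ3 _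
  -- the tolerance of the excess device
  have hη' : Neg.η κ Φ ≤ κ.δr 0 / 2 := by
    have h2 := (Neg.η_pos κ Φ).2.2
    have hk := Neg.δkit_le_δr κ Φ (n := 0) (by norm_num)
    linarith
  refine reachOblAtHNF_frmQ3VD_sndU hAt h1 hp0 hp1 mk hV hdu hne HK N (R := E - 3) ?_ hDQ' hDρ'' hρM' (R₀ := E') hdeep'
    hPR hLl hLt ha hBx hbL haW haW' hbq ?_
    (φe := (fineOA κ Φ t p O.D O.DT.toDataN O.ori (gOf κ Φ t p O gv) (fOf κ Φ t p O fv))) (Rw := E) (m' := 25 * ((fcellsV κ Φ t p O.merged (gOf κ Φ t p O gv) (fOf κ Φ t p O fv) (cOf κ Φ t p O gv fv cv) (hOf κ Φ t p O gv fv hv))).rmax) (m := 50 * (fcellsA κ Φ t p O.merged (gOf κ Φ t p O gv) (fOf κ Φ t p O fv)).rmax) (R₁ := (SUS ex mx κ Φ t p O.merged (gOf κ Φ t p O gv) (fOf κ Φ t p O fv) q).Rex E')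
    (ctr := ((fcellsV κ Φ t p O.merged (gOf κ Φ t p O gv) (fOf κ Φ t p O fv) (cOf κ Φ t p O gv fv cv) (hOf κ Φ t p O gv fv hv))).cenS (tgt e)) ?_ ?_ ?_ ?_ ?_ hnmax
  · -- hr₀R : r₀0 ≤ E − 3
    omega
  · -- hRD : (cOffS‖x‖₁ + 1) + 13·(box) ≤ E − 3
    set Zb : ℤ := (((N : ℤ) + 1) * (((nL κ Φ t p O.merged (gOf κ Φ t p O gv) (fOf κ Φ t p O fv)) * (ℓL κ Φ t p O.merged (gOf κ Φ t p O gv) (fOf κ Φ t p O fv)) / Skelφ.shearUnit (nL κ Φ t p O.merged (gOf κ Φ t p O gv) (fOf κ Φ t p O fv)) (hL κ Φ t p O.merged (gOf κ Φ t p O gv) (fOf κ Φ t p O fv)) + 1 : ℕ) : ℤ) + Skelφ.kgZY₀ (nL κ Φ t p O.merged (gOf κ Φ t p O gv) (fOf κ Φ t p O fv)) (vL κ Φ t p O.merged (gOf κ Φ t p O gv) (fOf κ Φ t p O fv)) (KS0.R'0 κ Φ t p O.merged mk) ρ W N (Skelφ.kgM₁Y (nL κ Φ t p O.merged (gOf κ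 Φ t p O gv) (fOf κ Φ t p O fv)) (vL κ Φ t p O.merged (gOf κ Φ t p O gv) (fOf κ Φ t p O fv)) (KS0.R'0 κ Φ t p O.merged mk) ρ W N) (Skelφ.kgWm₂Y (nL κ Φ t p O.merged (gOf κ Φ t p O gv) (fOf κ Φ t p O fv)) (vL κ Φ t p O.merged (gOf κ Φ t p O gv) (fOf κ Φ t p O fv)) (KS0.R'0 κ Φ t p O.merged mk) ρ W N) (Skelφ.kgWp₂Y (nL κ Φ t p O.merged (gOf κ Φ t p O gv) (fOf κ Φ t p O fv)) (vL κ Φ t p O.merged (gOf κ Φ t p O gv) (fOf κ Φ t p O fv)) (KS0.R'0 κ Φ t p O.merged mk) ρ W N) (Skelφ.kgM₂Y (nL κ Φ t p O.merged (gOf κ Φ t p O gv) (fOf κ Φ t p O fv)) (ℓL κ Φ t p O.merged (gOf κ Φ t p O gv) (fOf κ Φ t p O fv)) (hL κ Φ t p O.merged (gOf κ Φ t p O gv) (fOf κ Φ t p O fv)) (vL κ Φ t p O.merged (gOf κ Φ t p O gv) (fOf κ Φ t p O fv)) (KS0.R'0 κ Φ t p O.merged mk) ρ qq W N) + Skelφ.kgZY₁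 (nL κ Φ t p O.merged (gOf κ Φ t p O gv) (fOf κ Φ t p O fv)) (ℓL κ Φ t p O.merged (gOf κ Φ t p O gv) (fOf κ Φ t p O fv)) (hL κ Φ t p O.merged (gOf κ Φ t p O gv) (fOf κ Φ t p O fv)) (KS0.R'0 κ Φ t p O.merged mk) ρ qq N (Skelφ.kgM₁Y (nL κ Φ t p O.merged (gOf κ Φ t p O gv) (fOf κ Φ t p O fv)) (vL κ Φ t p O.merged (gOf κ Φ t p O gv) (fOf κ Φ t p O fv)) (KS0.R'0 κ Φ t p O.merged mk) ρ W N) (Skelφ.kgM₂Y (nL κ Φ t p O.merged (gOf κ Φ t p O gv) (fOf κ Φ t p O fv)) (ℓL κ Φ t p O.merged (gOf κ Φ t p O gv) (fOf κ Φ t p O fv)) (hL κ Φ t p O.merged (gOf κ Φ t p O gv) (fOf κ Φ t p O fv)) (vL κ Φ t p O.merged (gOf κ Φ t p O gv) (fOf κ Φ t p O fv)) (KS0.R'0 κ Φ t p O.merged mk) ρ qq W N)) with hZb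
    have hcast : (((E - 3 : ℕ)) : ℤ) = (E : ℤ) - 3 := by omega
    rw [hcast]
    have hlinZ : ((Skelφ.Prm.E₀ (SUS ex mx κ Φ t p O.merged (gOf κ Φ t p O gv) (fOf κ Φ t p O fv) q) : ℕ) : ℤ) + ((cOffS κ Φ t p O.merged (gOf κ Φ t p O gv) (fOf κ Φ t p O fv) * (((tgt e) 0).natAbs + ((tgt e) 1).natAbs) + 1 : ℕ) : ℤ) ≤ (E : ℤ) + 1 := by
      have := hlin'; push_cast at this ⊢; linarith
    linarith [hρ2, hlinZ]
  · -- hWπ : the world lies in `B(t, E)`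
    intro b hb
    exact Skelφ.mem_graphBall_of_mem_Ewv_Hfull₂bV (le_of_eq hrB') (le_of_eq hrQ') (fun ℓ => (le_of_eq (hρ' ℓ)).trans (Nat.sub_le _ _)) hb
  · -- hWpl : planar footprints in `cenS x + Λ_(25·rmax)`
    intro b hb
    exact Skelφ.ψ_mem_box_image_of_mem_Ewv_Hfull₂bV hb
  · -- hm
    show 2 * (25 * (fcellsA κ Φ t p O.merged (gOf κ Φ t p O gv) (fOf κ Φ t p O fv)).rmax) ≤ 50 * (fcellsA κ Φ t p O.merged (gOf κ Φ t p O gv) (fOf κ Φ t p O fv)).rmax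
    omega
  · -- hR₁ : the excess device at entrance depth `E' + 1`, fine-map diameter `50·rmax`
    intro R'' hR'' Rw' D' A' hD' hdiam hAD hA
    exact hR₁_US κ Φ t p O.merged (gOf κ Φ t p O gv) (fOf κ Φ t p O fv) ex mx q hCq (oL κ Φ t p O.D O.DT.toDataN O.ori (gOf κ Φ t p O gv) (fOf κ Φ t p O fv)) hη' t E' R'' hR'' Rw' D' A' hD'
      (fun d hd d' hd' => fine_diam_le_mRS κ Φ t p O.merged (gOf κ Φ t p O gv) (fOf κ Φ t p O fv) (mx κ Φ t p O.merged (gOf κ Φ t p O gv) (fOf κ Φ t p O fv)) hN (hdiam d hd d' hd')) hAD hA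
  · -- hR₁R : Rex E' ≤ (E − 3) − r₀0  (one gap absorbs the excess)
    omega

end Rad

end NegB

end PlanarSkeletonFrm

end Summit.CriticalPhenomena.PercolationContinuityZ3.Theorems.Transplant

end
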